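import Summits.QuantumFields.BalabanUV.T4Continuum.Spine.NE4.AutonomousSchemeLinearized

/-!
# Spine/NE4/AutonomousSchemeLinearizedSharp — (R43) companion: the price `θ′ + Kc·δ` of the linearization principle is ATTAINED (scalar witness)

Cell `pub-balaban-gaps` (YM blitz G2), seat `ne4`, generation 10 (unit `pub-balaban-gaps-ne4-g10`); record `HOME/ne/NE4.md` §5 (R43)(f).
HONEST FRAMING as in `AutonomousSchemeLinearized`: a TOY scalar scheme on `ℝ` and elementary bookkeeping; no Bałaban object; NE4
(`T4CouplingMatching.ScaleShiftRate`, NOT IN PRINT) is NOT proved; nothing of Bałaban's is asserted; no status word moves (NE4 DEPENDENT, spine 0∕9).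
One finite T⁴; NOT ℝ⁴, NOT infinite volume, NOT a mass gap, NOT Clay.

THE POINT.  `AutonomousSchemeLinearized.orbitStability_of_linearDefect` turns ONE contracting power `‖T₀ ^ N‖ ≤ θ′ ^ N` of the linearised step plus a
δ-Lipschitz linearization defect into `Markov.OrbitStability A S Kc (θ′ + Kc·δ) γ`.  Is the degraded rate `θ′ + Kc·δ` an artefact of the gauge argument?  NO:
the scalar scheme `scal ρ g x = ρ·x + g` with slope `ρ = θ₀ + δ` has defect EXACTLY `δ` relative to the reference `θ₀ • 1` (`linearDefect_scal`), the
reference contracts in one step (`‖(θ₀ • 1) ^ 1‖ ≤ θ₀ ^ 1`, `norm_pow_one_scalRef`) with adapted constant `Kc (θ₀ • 1) θ₀ 1 = 1` (`Kc_scalRef`), so the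
principle gives `OrbitStability _ univ 1 (θ₀ + δ) γ` (`orbitStability_scal`) — and orbit differences are EXACTLY `ρⁿ(x − y)` (`iter_scal_sub`), so NO rate
`ρ′ < θ₀ + δ` holds with ANY constant (`not_orbitStability_scal`).  Packaged: `linearDefect_rate_exact`.  §7 quantifies the price of a FIXED block size: with `‖T₀‖ ≤ M` (a block-spin step may have `M > 1`) the
adapted constant obeys `Kc T₀ θ′ N ≤ Σ_{n<N}(M∕θ′)ⁿ` (`Kc_le_geom_sum`), so the admissible defect `δ < (1 − θ′)∕Σ_{n<N}(M∕θ′)ⁿ` is small but positive at every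
fixed `L` (`orbitStability_at_rate`: a prescribed rate `θ″ > θ′` is met once `(Σ_{n<N}(M∕θ′)ⁿ)·δ ≤ θ″ − θ′`).  (The defect can of course be absorbed into a better
reference — `T₀ = (θ₀ + δ) • 1` has defect 0 —; the witness says only that, GIVEN the reference, the price in δ is sharp, as
`T4SpectralRenewal.cocycleBound_of_near_ref`'s is for linear perturbations.)
-/

namespace Summit.QuantumFields.BalabanUV.T4Continuum.Spine.NE4

open Literature.MathematicalPhysics.QuantumFieldTheory.Balaban1983to89.T4FlagMemory (Adm)
open Literature.MathematicalPhysics.QuantumFieldTheory.Balaban1983to89.T4SpectralRenewal (Kc Kc_nonneg)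
open Finset

namespace Markov

/-! ## §6 (of (R43)) Exactness: the price `θ′ + Kc·δ` is attained by a scalar scheme -/

section Witness

/-- The SCALAR scheme `x ↦ ρ·x + g` on `ℝ` (toy; no Bałaban object). [folklore] -/
def scal (ρ : ℝ) : ℝ → ℝ → ℝ := fun g x => ρ * x + g

/-- Along any coupling sequence the difference of two orbits of `scal ρ` is multiplied by EXACTLY `ρ` per step. [folklore] -/
theorem iter_scal_sub (ρ : ℝ) (g : ℕ → ℝ) (i : ℕ) : ∀ n (x y : ℝ), iter (scal ρ) g i n x - iter (scal ρ) g i n y = ρ ^ n * (x - y)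
  | 0, x, y => by simp
  | n + 1, x, y => by
    rw [iter_succ, iter_succ]
    simp only [scal]
    rw [show ρ * iter (scal ρ) g i n x + g (i + n) - (ρ * iter (scal ρ) g i n y + g (i + n))
        = ρ * (iter (scal ρ) g i n x - iter (scal ρ) g i n y) by ring, iter_scal_sub ρ g i n x y]
    ring

/-- The scalar scheme with slope `θ₀ + δ` has `LinearDefect` EXACTLY `δ` relative to the reference `θ₀ • 1` (on any set). [folklore] -/
theorem linearDefect_scal {θ₀ δ γ : ℝ} (hδ : 0 ≤ δ) (S : Set ℝ) :
    LinearDefect (scal (θ₀ + δ)) (θ₀ • (1 : ℝ →L[ℝ] ℝ)) S δ γ := by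
  intro g _ _ x _ y _
  simp only [scal, smul_apply, one_apply_eq_self, smul_eq_mul]
  rw [show (θ₀ + δ) * x + g - ((θ₀ + δ) * y + g) - θ₀ * (x - y) = δ * (x - y) by ring, norm_mul, Real.norm_eq_abs,
    abs_of_nonneg hδ]

/-- The reference `θ₀ • 1` contracts in ONE step at rate `θ₀` (`θ₀ ≥ 0`): `‖(θ₀ • 1) ^ 1‖ ≤ θ₀ ^ 1`. [folklore] -/
theorem norm_pow_one_scalRef {θ₀ : ℝ} (hθ : 0 ≤ θ₀) : ‖(θ₀ • (1 : ℝ →L[ℝ] ℝ)) ^ 1‖ ≤ θ₀ ^ 1 := by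
  rw [pow_one, pow_one, norm_smul, norm_one, mul_one, Real.norm_eq_abs, abs_of_nonneg hθ]

/-- The adapted constant of the scalar reference at depth 1 is `1`. [folklore] -/
theorem Kc_scalRef (θ₀ : ℝ) : Kc (θ₀ • (1 : ℝ →L[ℝ] ℝ)) θ₀ 1 = 1 := by
  simp [Kc]

/-- All of `ℝ` is invariant under the scalar scheme. [folklore] -/
theorem invariant_scal_univ (ρ γ : ℝ) : Invariant (scal ρ) Set.univ γ := fun _ _ _ _ _ => Set.mem_univ _

/-- §3 APPLIED TO THE SCALAR SCHEME: `OrbitStability (scal (θ₀ + δ)) univ 1 (θ₀ + δ) γ` — constant `Kc = 1`, rate `θ₀ + 1·δ`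
(`orbitStability_of_linearDefect` with `N = 1`; `θ₀ > 0`, `δ ≥ 0`). [folklore] -/
theorem orbitStability_scal {θ₀ δ γ : ℝ} (hθ : 0 < θ₀) (hδ : 0 ≤ δ) :
    OrbitStability (scal (θ₀ + δ)) Set.univ 1 (θ₀ + δ) γ := by
  have h := orbitStability_of_linearDefect (S := Set.univ) (γ := γ) hθ le_rfl (norm_pow_one_scalRef hθ.le)
    (invariant_scal_univ (θ₀ + δ) γ) (linearDefect_scal hδ Set.univ) hδ
  simpa [Kc_scalRef] using h

/-- **NO SMALLER RATE WITH ANY CONSTANT**: for `0 ≤ ρ′ < ρ` and `γ > 0` the scalar scheme `scal ρ` is NOT orbit-stable at rate `ρ′` on `univ`, whatever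
the constant `C` (orbit differences are exactly `ρⁿ(x − y)`, `iter_scal_sub`, and `C·(ρ′∕ρ)ⁿ → 0`). [folklore] -/
theorem not_orbitStability_scal {ρ ρ' γ C : ℝ} (hγ : 0 < γ) (hρ'0 : 0 ≤ ρ') (hρ' : ρ' < ρ) :
    ¬ OrbitStability (scal ρ) Set.univ C ρ' γ := by
  intro h
  have hρ0 : 0 < ρ := hρ'0.trans_lt hρ'
  have hq0 : 0 ≤ ρ' / ρ := div_nonneg hρ'0 hρ0.le
  have hq1 : ρ' / ρ < 1 := (div_lt_one hρ0).mpr hρ'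
  -- along the constant admissible sequence `γ`, starting at `1` and `0`: `ρ ^ n ≤ C * ρ' ^ n` for all `n`
  have hall : ∀ n : ℕ, ρ ^ n ≤ C * ρ' ^ n := by
    intro n
    have h1 := h (fun _ => γ) (fun _ => ⟨hγ, le_rfl⟩) 0 n 1 (Set.mem_univ _) 0 (Set.mem_univ _)
    rw [Real.dist_eq, iter_scal_sub, Real.dist_eq] at h1
    simpa [abs_of_pos hρ0] using h1
  -- hence `1 ≤ C * (ρ'/ρ)^n` for all `n`, contradicting `(ρ'/ρ)^n → 0`
  have hall' : ∀ n : ℕ, (1 : ℝ) ≤ C * (ρ' / ρ) ^ n := by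
    intro n
    have hn := hall n
    rw [div_pow, mul_div_assoc', le_div_iff₀ (pow_pos hρ0 n), one_mul]
    exact hn
  have hlim : Filter.Tendsto (fun n : ℕ => C * (ρ' / ρ) ^ n) Filter.atTop (nhds (C * 0)) :=
    (tendsto_pow_atTop_nhds_zero_of_lt_one hq0 hq1).const_mul C
  rw [mul_zero] at hlim
  have hev := (hlim.eventually (gt_mem_nhds (show (0 : ℝ) < 1 from one_pos)))
  obtain ⟨n, hn⟩ := hev.exists
  exact absurd (hall' n) (not_le.mpr hn)

/-- **THE PRICE `θ′ + Kc·δ` IS ATTAINED**: for `θ₀ > 0`, `δ ≥ 0`, `γ > 0` the scalar scheme `scal (θ₀ + δ)` carries the hypotheses of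
`orbitStability_of_linearDefect` with `‖T₀ ^ 1‖ ≤ θ₀ ^ 1`, `Kc = 1`, defect `δ`; it IS orbit-stable at rate `θ₀ + δ` with constant 1, and at NO rate
`ρ′ < θ₀ + δ` with any constant.  (Toy; no Bałaban object.) [folklore] -/
theorem linearDefect_rate_exact {θ₀ δ γ : ℝ} (hθ : 0 < θ₀) (hδ : 0 ≤ δ) (hγ : 0 < γ) :
    LinearDefect (scal (θ₀ + δ)) (θ₀ • (1 : ℝ →L[ℝ] ℝ)) Set.univ δ γ ∧
    ‖(θ₀ • (1 : ℝ →L[ℝ] ℝ)) ^ 1‖ ≤ θ₀ ^ 1 ∧ Kc (θ₀ • (1 : ℝ →L[ℝ] ℝ)) θ₀ 1 = 1 ∧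
    OrbitStability (scal (θ₀ + δ)) Set.univ 1 (θ₀ + δ) γ ∧
    ∀ ρ' C : ℝ, 0 ≤ ρ' → ρ' < θ₀ + δ → ¬ OrbitStability (scal (θ₀ + δ)) Set.univ C ρ' γ :=
  ⟨linearDefect_scal hδ _, norm_pow_one_scalRef hθ.le, Kc_scalRef θ₀, orbitStability_scal hθ hδ,
    fun _ _ hρ'0 hρ' => not_orbitStability_scal hγ hρ'0 hρ'⟩

end Witness


/-! ## §7 (of (R43)) The price of a large one-step norm: `Kc ≤ Σ_{n<N} (‖T₀‖∕θ′)ⁿ` — polynomial in the one-step norm, of degree `N − 1` -/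

section Price

variable {E : Type*} [NormedAddCommGroup E] [NormedSpace ℝ E]

/-- Operator-norm powers: `‖T ^ n‖ ≤ ‖T‖ ^ n` (with `‖1‖ ≤ 1` at `n = 0`, no nontriviality of `E` needed). [folklore] -/
theorem opNorm_pow_le (T : E →L[ℝ] E) : ∀ n : ℕ, ‖T ^ n‖ ≤ ‖T‖ ^ n
  | 0 => by rw [pow_zero, pow_zero, ContinuousLinearMap.one_def]; exact ContinuousLinearMap.norm_id_le
  | n + 1 => by
    rw [pow_succ, pow_succ]
    exact (norm_mul_le _ _).trans (mul_le_mul_of_nonneg_right (opNorm_pow_le T n) (norm_nonneg _))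

/-- **THE PRICE OF A FIXED BLOCK SIZE, QUANTIFIED**: if the one-step norm of the linearisation is `‖T₀‖ ≤ M` (possibly `M > 1` — a block-spin step sums
`L⁴` blocks) and the depth-`N` power contracts, the adapted constant multiplying the defect in `orbitStability_of_linearDefect` obeys
`Kc T₀ θ′ N ≤ Σ_{n<N} (M∕θ′)ⁿ` — polynomial of degree `N − 1` in `M∕θ′`; so the admissible defect is `δ < (1 − θ′)∕Σ_{n<N}(M∕θ′)ⁿ`, small but POSITIVE at
every fixed `L`.  (At `N = 1`, one-step contraction, `Kc = 1`.) [folklore] -/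
theorem Kc_le_geom_sum (T : E →L[ℝ] E) {θ' M : ℝ} (hθ : 0 < θ') (hM : ‖T‖ ≤ M) (N : ℕ) :
    Kc T θ' N ≤ ∑ n ∈ range N, (M / θ') ^ n := by
  unfold Kc
  refine Finset.sum_le_sum fun n _ => ?_
  calc θ'⁻¹ ^ n * ‖T ^ n‖ ≤ θ'⁻¹ ^ n * M ^ n :=
        mul_le_mul_of_nonneg_left ((opNorm_pow_le T n).trans (pow_le_pow_left₀ (norm_nonneg _) hM n))
          (pow_nonneg (inv_nonneg.mpr hθ.le) _)
    _ = (M / θ') ^ n := by rw [div_eq_mul_inv, mul_pow, mul_comm]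

/-- **ADMISSIBLE DEFECT AT FIXED `L`** (§3 of `AutonomousSchemeLinearized` + `Kc_le_geom_sum`): with `‖T₀‖ ≤ M`, `‖T₀ ^ N‖ ≤ θ′ ^ N` and a defect
`δ ≤ δ₀` where `(Σ_{n<N}(M∕θ′)ⁿ)·δ₀ ≤ θ″ − θ′`, the scheme is orbit-stable at the prescribed rate `θ″` with constant `Σ_{n<N}(M∕θ′)ⁿ`. [folklore] -/
theorem orbitStability_at_rate {A : ℝ → E → E} {T₀ : E →L[ℝ] E} {S : Set E} {θ' θ'' M δ γ : ℝ} {N : ℕ}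
    (hθ : 0 < θ') (hN : 1 ≤ N) (hT : ‖T₀ ^ N‖ ≤ θ' ^ N) (hM : ‖T₀‖ ≤ M)
    (hInv : Invariant A S γ) (hdef : LinearDefect A T₀ S δ γ) (hδ : 0 ≤ δ)
    (hbudget : (∑ n ∈ range N, (M / θ') ^ n) * δ ≤ θ'' - θ') :
    OrbitStability A S (∑ n ∈ range N, (M / θ') ^ n) θ'' γ := by
  have hK : 0 ≤ Kc T₀ θ' N := Kc_nonneg T₀ hθ.le N
  have hKle : Kc T₀ θ' N ≤ ∑ n ∈ range N, (M / θ') ^ n := Kc_le_geom_sum T₀ hθ hM N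
  refine (orbitStability_of_linearDefect hθ hN hT hInv hdef hδ).mono hKle (by positivity) ?_ (hK.trans hKle)
  have : Kc T₀ θ' N * δ ≤ (∑ n ∈ range N, (M / θ') ^ n) * δ := mul_le_mul_of_nonneg_right hKle hδ
  linarith

end Price

end Markov

end Summit.QuantumFields.BalabanUV.T4Continuum.Spine.NE4
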